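import Mathlib
import Summits.KontsevichZagierPeriods.Zeta5Search.PalindromeLemma
import Summits.KontsevichZagierPeriods.Zeta5Search.PalindromicClassBounds
import Summits.KontsevichZagierPeriods.Zeta5Search.UniversalDigitW
import HarnessLib

/-!
# ζ(5) search — the PALINDROME BONUS for the ζ(5)-coefficient: `min(uLBpal, 1) ≤ v_p(U(b))` in the window

Cell `pub-zeta5` (HONEST FRAMING: systematic search; no irrationality claim unless certified), typer seat
generation 9.  The `U`-companion of `PalindromicWBound.lean` for census g13's conjecture `PalindromicClassBoundU`
(`Zeta5Search/PalindromicClassBounds.lean`):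

* `rhoSum_eq_zero_of_palindromic`: the palindrome lemma for every order `σ` — `Σ_{poles of order ≥ σ} ρ_{q,σ} = 0` when the
  class configuration is palindromic and `σ + E_x` is odd (gen-2 g6 §4a; via `classRho_invol` of `PalindromeLemma.lean`);
* `uDigit`: the universal first digit of the `U`-row, `Σ_{s∈x} c_{4,s} = (−p)^{E_x+5}(ĝ_q·Σ_{order ≥ 5} ρ_{s,5} + O(p))`
  (Theorem B at `σ = 5`, exactly as P1 g5's `CellA.wDigit` at `σ = 3`);
* `min_uLBpal_one_le_padicValRat_coeffU : InPolytope b → p.Prime → 5 ≤ p → b₀+2 < p² → U(b) ≠ 0 → min (uLBpal b p) 1 ≤ v_p(U(b))`.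
`p`-adic valuations of rational numbers; nothing about irrationality.
-/

noncomputable section

open Finset PowerSeries

namespace Summit.KontsevichZagierPeriods.Zeta5Search.ClusterValuation

open Summit.KontsevichZagierPeriods.Zeta5Search.DualSeries (InBox)
open Summit.KontsevichZagierPeriods.Zeta5Search.WedgeDictionary (coeffU pfData dOf)
open Summit.KontsevichZagierPeriods.Zeta5Search.CasoratianValuation (InPolytope)
open Summit.KontsevichZagierPeriods.Zeta5Search.PadicSeries
open Summit.KontsevichZagierPeriods.Zeta5Search.CellA (gHat_classCongr padicNorm_classRho_le_one pfData_eq_zero_of_order_le)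

/-! ### The palindrome lemma for every order -/

section Invol

variable (b : ℕ → ℤ) {p x : ℕ} (τ : ℕ → ℕ)
  (hD : ∀ s ∈ (classSet b p x).filter (fun s => netExp b s ≠ 0), τ s ∈ (classSet b p x).filter (fun s => netExp b s ≠ 0))
  (hinv : ∀ s ∈ (classSet b p x).filter (fun s => netExp b s ≠ 0), τ (τ s) = s)
  (he : ∀ s ∈ (classSet b p x).filter (fun s => netExp b s ≠ 0), netExp b (τ s) = netExp b s)
  (hlin : ∀ s ∈ (classSet b p x).filter (fun s => netExp b s ≠ 0), ∀ t ∈ (classSet b p x).filter (fun s => netExp b s ≠ 0),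
    ((τ s : ℚ) - τ t) = -((s : ℚ) - t))
  (hcen : (¬ (2 : ℤ) ∣ b 0 ∧ CentreIn b p x) → ∀ s ∈ (classSet b p x).filter (fun s => netExp b s ≠ 0),
    (τ s : ℚ) - (b 0 : ℚ) / 2 = -((s : ℚ) - (b 0 : ℚ) / 2))

include hD hinv he hlin hcen in
/-- `Σ_{poles of order ≥ σ} ρ_{q,σ} = 0` when `σ + E_x` is odd and the class admits a level-reversing involution (`σ ≥ 1`). -/
theorem rhoSum_eq_zero_of_invol {σ : ℕ} (hσ : 1 ≤ σ) (hodd : Odd ((σ : ℤ) + classExp b p x)) :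
    ∑ q ∈ (classSet b p x).filter (fun s => netExp b s ≤ -(σ : ℤ)), classRho b p q σ = 0 := by
  set D := (classSet b p x).filter (fun s => netExp b s ≠ 0) with hDdef
  set P := (classSet b p x).filter (fun s => netExp b s ≤ -(σ : ℤ)) with hP
  have hPD : ∀ s ∈ P, s ∈ D := fun s hs => by
    obtain ⟨hs1, hs2⟩ := mem_filter.1 hs
    exact mem_filter.2 ⟨hs1, by omega⟩
  have hτP : ∀ s ∈ P, τ s ∈ P := fun s hs => by
    have hsD := hPD s hs
    refine mem_filter.2 ⟨(mem_filter.1 (hD s hsD)).1, ?_⟩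
    rw [he s hsD]; exact (mem_filter.1 hs).2
  have hflip : ∑ q ∈ P, classRho b p q σ = ∑ q ∈ P, classRho b p (τ q) σ :=
    (sum_nbij' τ τ hτP hτP (fun s hs => hinv s (hPD s hs)) (fun s hs => hinv s (hPD s hs)) (fun _ _ => rfl)).symm
  have hneg : ∑ q ∈ P, classRho b p (τ q) σ = -∑ q ∈ P, classRho b p q σ := by
    rw [← sum_neg_distrib]
    refine sum_congr rfl fun q hq => ?_
    have hqD := hPD q hq
    have hqn : q ≤ (b 0).toNat := le_of_mem_classSet b (mem_filter.1 hq).1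
    rw [classRho_invol b τ hD hinv he hlin hcen hqD hqn (by have := (mem_filter.1 hq).2; omega),
      show classExp b p x + (σ : ℤ) = (σ : ℤ) + classExp b p x by ring, hodd.neg_one_zpow]
    ring
  linarith

end Invol

/-- A self-conjugate class admits the conjugation `s ↦ b₀ − s` as a level-reversing involution. -/
theorem exists_invol_of_centreIn (b : ℕ → ℤ) (h0 : 0 ≤ b 0) {p x : ℕ} (hcx : CentreIn b p x) :
    ∃ τ : ℕ → ℕ,
      (∀ s ∈ (classSet b p x).filter (fun s => netExp b s ≠ 0), τ s ∈ (classSet b p x).filter (fun s => netExp b s ≠ 0)) ∧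
      (∀ s ∈ (classSet b p x).filter (fun s => netExp b s ≠ 0), τ (τ s) = s) ∧
      (∀ s ∈ (classSet b p x).filter (fun s => netExp b s ≠ 0), netExp b (τ s) = netExp b s) ∧
      (∀ s ∈ (classSet b p x).filter (fun s => netExp b s ≠ 0), ∀ t ∈ (classSet b p x).filter (fun s => netExp b s ≠ 0),
        ((τ s : ℚ) - τ t) = -((s : ℚ) - t)) ∧
      ((¬ (2 : ℤ) ∣ b 0 ∧ CentreIn b p x) → ∀ s ∈ (classSet b p x).filter (fun s => netExp b s ≠ 0),
        (τ s : ℚ) - (b 0 : ℚ) / 2 = -((s : ℚ) - (b 0 : ℚ) / 2)) := by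
  set n := (b 0).toNat with hn
  have hb0 : ((n : ℕ) : ℤ) = b 0 := Int.toNat_of_nonneg h0
  have hb0Q : ((n : ℕ) : ℚ) = ((b 0 : ℤ) : ℚ) := by exact_mod_cast hb0
  have hC : ∀ s ∈ classSet b p x, n - s ∈ classSet b p x := by
    intro s hs
    obtain ⟨hsn, hres⟩ := mem_filter.1 hs
    rw [mem_range] at hsn
    refine mem_filter.2 ⟨mem_range.2 (by omega), ?_⟩
    have h1 : (p : ℤ) ∣ (x : ℤ) - ((n - s : ℕ) : ℤ) := by
      obtain ⟨k, hk⟩ := hcx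
      have h2 : (p : ℤ) ∣ (s : ℤ) - x := by
        rw [dvd_sub_comm]; exact Nat.modEq_iff_dvd.1 hres
      obtain ⟨k2, hk2⟩ := h2
      refine ⟨k + k2, ?_⟩
      push_cast [Nat.cast_sub (show s ≤ n by omega)]
      rw [← hb0] at hk
      linear_combination hk + hk2
    exact Nat.modEq_iff_dvd.2 h1
  have hDn : ∀ s ∈ (classSet b p x).filter (fun s => netExp b s ≠ 0), s ≤ n :=
    fun s hs => le_of_mem_classSet b (mem_filter.1 hs).1
  refine ⟨fun s => n - s, fun s hs => ?_, fun s hs => ?_, fun s hs => ?_, fun s hs t ht => ?_, fun _ s hs => ?_⟩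
  · obtain ⟨hsC, hse⟩ := mem_filter.1 hs
    exact mem_filter.2 ⟨hC s hsC, by rwa [netExp_reflect b h0 (hDn s hs)]⟩
  · have := hDn s hs
    show n - (n - s) = s
    omega
  · exact netExp_reflect b h0 (hDn s hs)
  · have h1 := hDn s hs; have h2 := hDn t ht
    push_cast [Nat.cast_sub h1, Nat.cast_sub h2]; ring
  · have h1 := hDn s hs
    push_cast [Nat.cast_sub h1]
    rw [hb0Q]; ring

/-- A palindromic class not containing the centre admits the reflection of its configuration as a level-reversing involution. -/
theorem exists_invol_of_palindromic (b : ℕ → ℤ) {p x : ℕ} (hcx : ¬ CentreIn b p x)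
    (hpal : IsPalindromic (classConfig b p x)) :
    ∃ τ : ℕ → ℕ,
      (∀ s ∈ (classSet b p x).filter (fun s => netExp b s ≠ 0), τ s ∈ (classSet b p x).filter (fun s => netExp b s ≠ 0)) ∧
      (∀ s ∈ (classSet b p x).filter (fun s => netExp b s ≠ 0), τ (τ s) = s) ∧
      (∀ s ∈ (classSet b p x).filter (fun s => netExp b s ≠ 0), netExp b (τ s) = netExp b s) ∧
      (∀ s ∈ (classSet b p x).filter (fun s => netExp b s ≠ 0), ∀ t ∈ (classSet b p x).filter (fun s => netExp b s ≠ 0),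
        ((τ s : ℚ) - τ t) = -((s : ℚ) - t)) ∧
      ((¬ (2 : ℤ) ∣ b 0 ∧ CentreIn b p x) → ∀ s ∈ (classSet b p x).filter (fun s => netExp b s ≠ 0),
        (τ s : ℚ) - (b 0 : ℚ) / 2 = -((s : ℚ) - (b 0 : ℚ) / 2)) := by
  set D := (classSet b p x).filter (fun s => netExp b s ≠ 0) with hDdef
  have hconf : classConfig b p x = D.image fun s => ((((2 * s : ℕ)) : ℤ), netExp b s) := by
    unfold classConfig; rw [if_neg (fun h => hcx h.2), union_empty]
  obtain ⟨m, -, hm⟩ := hpal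
  rw [hconf] at hm
  have hpart : ∀ s ∈ D, ∃ s' ∈ D, (2 * (s' : ℤ)) = m - 2 * s ∧ netExp b s' = netExp b s := by
    intro s hs
    have h1 := hm _ (mem_image_of_mem _ hs)
    obtain ⟨s', hs', he⟩ := mem_image.1 h1
    simp only [Prod.mk.injEq] at he
    refine ⟨s', hs', ?_, he.2⟩
    have := he.1; push_cast at this ⊢; linarith
  set τ : ℕ → ℕ := fun s => ((m - 2 * (s : ℤ)) / 2).toNat with hτ
  have hτval : ∀ s ∈ D, ∀ s' ∈ D, (2 * (s' : ℤ)) = m - 2 * s → τ s = s' := by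
    intro s _ s' _ h
    simp only [hτ]
    rw [← h, Int.mul_ediv_cancel_left _ (by norm_num : (2 : ℤ) ≠ 0), Int.toNat_natCast]
  have hτD : ∀ s ∈ D, τ s ∈ D ∧ netExp b (τ s) = netExp b s ∧ (2 * ((τ s : ℕ) : ℤ)) = m - 2 * s := by
    intro s hs
    obtain ⟨s', hs', h2, he⟩ := hpart s hs
    rw [hτval s hs s' hs' h2]
    exact ⟨hs', he, h2⟩
  refine ⟨τ, fun s hs => (hτD s hs).1, fun s hs => ?_, fun s hs => (hτD s hs).2.1, fun s hs t ht => ?_,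
    fun h => absurd h.2 hcx⟩
  · obtain ⟨hs', -, h2⟩ := hτD s hs
    exact hτval _ hs' s hs (by linarith)
  · have h1 := (hτD s hs).2.2
    have h2 := (hτD t ht).2.2
    have h1' : (2 : ℚ) * (τ s : ℚ) = (m : ℚ) - 2 * s := by exact_mod_cast h1
    have h2' : (2 : ℚ) * (τ t : ℚ) = (m : ℚ) - 2 * t := by exact_mod_cast h2
    linarith

/-- **The palindrome lemma for every order**: `Σ_{poles of order ≥ σ} ρ_{q,σ} = 0` for a palindromic class with `σ + E_x` odd. -/
theorem rhoSum_eq_zero_of_palindromic (b : ℕ → ℤ) (h0 : 0 ≤ b 0) {p x : ℕ} (hpal : IsPalindromic (classConfig b p x))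
    {σ : ℕ} (hσ : 1 ≤ σ) (hodd : Odd ((σ : ℤ) + classExp b p x)) :
    ∑ q ∈ (classSet b p x).filter (fun s => netExp b s ≤ -(σ : ℤ)), classRho b p q σ = 0 := by
  by_cases hcx : CentreIn b p x
  · obtain ⟨τ, hD, hinv, he, hlin, hcen⟩ := exists_invol_of_centreIn b h0 hcx
    exact rhoSum_eq_zero_of_invol b τ hD hinv he hlin hcen hσ hodd
  · obtain ⟨τ, hD, hinv, he, hlin, hcen⟩ := exists_invol_of_palindromic b hcx hpal
    exact rhoSum_eq_zero_of_invol b τ hD hinv he hlin hcen hσ hodd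

/-! ### The universal first digit of the `U`-row (Theorem B at `σ = 5`) -/

variable {p : ℕ} [hp : Fact p.Prime]

/-- **U-digit**: `v_p(Σ_{s∈x} c_{4,s} − (−p)^{E_x+5}·ĝ_q·Σ_{order ≥ 5} ρ_{s,5}) ≥ E_x + 6` for any pole `q` of the class. -/
theorem uDigit (b : ℕ → ℤ) {x q : ℕ} (hb : InPolytope b) (hp5 : 5 ≤ p) (hwin : (b 0 + 2 : ℤ) < (p : ℤ) ^ 2) (hx : x < p)
    (hq : q ∈ classSet b p x)
    (hne : (∑ s ∈ classSet b p x, pfData b 4 s) - (-(p : ℚ)) ^ (classExp b p x + 5) * gHat b p q *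
      (∑ s ∈ (classSet b p x).filter (fun s => netExp b s ≤ -5), classRho b p s 5) ≠ 0) :
    classExp b p x + 6 ≤ padicValRat p ((∑ s ∈ classSet b p x, pfData b 4 s) -
      (-(p : ℚ)) ^ (classExp b p x + 5) * gHat b p q *
        (∑ s ∈ (classSet b p x).filter (fun s => netExp b s ≤ -5), classRho b p s 5)) := by
  obtain ⟨hbox, -, -, hn⟩ := thmA_data b hb hwin
  have h0 : 0 ≤ b 0 := hbox.1
  have hprime := hp.out
  have hp2 : p ≠ 2 := by omega
  have hp' : (-(p : ℚ)) ≠ 0 := neg_ne_zero.2 (Nat.cast_ne_zero.2 hprime.ne_zero)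
  set E := classExp b p x with hE
  have hsum : ∑ s ∈ (classSet b p x).filter (fun s => netExp b s ≤ -5), classRho b p s 5 =
      ∑ s ∈ classSet b p x, (if netExp b s ≤ -5 then classRho b p s 5 else 0) := by
    rw [sum_filter]
  have hsplit : (∑ s ∈ classSet b p x, pfData b 4 s) - (-(p : ℚ)) ^ (E + 5) * gHat b p q *
      (∑ s ∈ (classSet b p x).filter (fun s => netExp b s ≤ -5), classRho b p s 5) =
      ∑ s ∈ classSet b p x, (pfData b 4 s - (-(p : ℚ)) ^ (E + 5) * gHat b p q *
        (if netExp b s ≤ -5 then classRho b p s 5 else 0)) := by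
    rw [hsum, mul_sum, ← sum_sub_distrib]
  have hpow : padicNorm p ((-(p : ℚ)) ^ (E + 5)) = (p : ℚ) ^ (-(E + 5)) := by
    rw [padicNorm.eq_zpow_of_nonzero (zpow_ne_zero _ hp'), padicValRat.zpow, padicValRat.neg,
      padicValRat.self hprime.one_lt, mul_one]
  have hterm : ∀ s ∈ classSet b p x,
      padicNorm p (pfData b 4 s - (-(p : ℚ)) ^ (E + 5) * gHat b p q *
        (if netExp b s ≤ -5 then classRho b p s 5 else 0)) ≤ (p : ℚ) ^ (-(E + 6)) := by
    intro s hs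
    have hsn : s ≤ (b 0).toNat := le_of_mem_classSet b hs
    by_cases h5 : netExp b s ≤ -5
    · rw [if_pos h5]
      have hEs : classExp b p s = E := classExp_eq_of_mem hs
      have hB : padicNorm p (pfData b 4 s - (-(p : ℚ)) ^ (E + 5) * gHat b p s * classRho b p s 5) ≤
          (p : ℚ) ^ (-(E + 6)) := by
        refine padicNorm_le_of_val fun hne' => ?_
        have := leadingDigit_holds b p s 5 hb hprime hp5 hwin hsn (by norm_num) (by omega)
          (by rw [hEs, show ((5 : ℕ) : ℤ) + E = E + 5 by ring]; exact hne')
        rw [hEs, show ((5 : ℕ) : ℤ) + E = E + 5 by ring] at this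
        push_cast at this ⊢; linarith
      have hgg : padicNorm p (gHat b p s - gHat b p q) ≤ (p : ℚ) ^ (-(1 : ℤ)) := by
        refine padicNorm_le_of_val fun hne' => ?_
        exact (gHat_classCongr b p x s q hb hprime hp5 hx hs hq).2 (sub_ne_zero.1 hne')
      have hρ := padicNorm_classRho_le_one b h0 hsn hn hp2 5
      have e : pfData b 4 s - (-(p : ℚ)) ^ (E + 5) * gHat b p q * classRho b p s 5 =
          (pfData b 4 s - (-(p : ℚ)) ^ (E + 5) * gHat b p s * classRho b p s 5) +
            (-(p : ℚ)) ^ (E + 5) * (gHat b p s - gHat b p q) * classRho b p s 5 := by ring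
      rw [e]
      refine (padicNorm.nonarchimedean (p := p)).trans (max_le hB ?_)
      rw [padicNorm.mul, padicNorm.mul, hpow]
      calc (p : ℚ) ^ (-(E + 5)) * padicNorm p (gHat b p s - gHat b p q) * padicNorm p (classRho b p s 5)
          ≤ (p : ℚ) ^ (-(E + 5)) * (p : ℚ) ^ (-(1 : ℤ)) * 1 :=
            mul_le_mul (mul_le_mul_of_nonneg_left hgg (zpow_p_nonneg _)) hρ (padicNorm.nonneg _)
              (mul_nonneg (zpow_p_nonneg _) (zpow_p_nonneg _))
        _ = (p : ℚ) ^ (-(E + 6)) := by rw [mul_one, ← zpow_add₀ (Nat.cast_ne_zero.2 hprime.ne_zero)]; ring_nf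
    · rw [if_neg h5, mul_zero, sub_zero, pfData_eq_zero_of_order_le b hb hsn (by norm_num) (by push_cast; omega),
        padicNorm.zero]
      exact zpow_p_nonneg _
  apply val_ge_of_padicNorm_le hne
  rw [hsplit]
  exact padicNorm.sum_le' hterm (zpow_p_nonneg _)

/-! ### The class pieces `U_x = Σ_{q ∈ x} c_{4,q}` -/

omit hp in
/-- `U_x = 0` for a class without poles. -/
theorem classUsum_eq_zero_of_noPole (b : ℕ → ℤ) (hb : InPolytope b) {x : ℕ} (hc : classPoleCount b p x = 0) :
    ∑ q ∈ classSet b p x, pfData b 4 q = 0 :=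
  sum_eq_zero fun q hq => pfData_eq_zero_of_netExp_nonneg b hb (le_of_mem_classSet b hq) (netExp_nonneg_of_noPole b hc hq)
    (by norm_num)

/-- `U_x` is `p`-integral for a single-pole class. -/
theorem padicNorm_classUsum_le_one (b : ℕ → ℤ) (hb : InPolytope b) (hp5 : 5 ≤ p) (hwin : (b 0 + 2 : ℤ) < (p : ℤ) ^ 2)
    {x : ℕ} (hone : classPoleCount b p x = 1) : padicNorm p (∑ q ∈ classSet b p x, pfData b 4 q) ≤ 1 := by
  refine padicNorm.sum_le' (fun q hq => ?_) zero_le_one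
  by_cases hz : pfData b 4 q = 0
  · rw [hz, padicNorm.zero]; exact zero_le_one
  have hcq : classPoleCount b p q = 1 := by unfold classPoleCount; rw [classSet_eq_of_mem hq]; exact hone
  have hv := isolatedPoleIntegral_holds b p q 4 hb hp.out (by omega) hwin (le_of_mem_classSet b hq) (by norm_num) hz hcq
  have h := padicNorm_le_of_val (p := p) (x := pfData b 4 q) (m := 0) (fun _ => hv)
  simpa using h

/-- **The multipole `U`-rows WITH the palindrome bonus**: `‖U_x‖_p ≤ p^{−classBound(x,5)}`. -/
theorem padicNorm_classUsum_le_classBound (b : ℕ → ℤ) (hb : InPolytope b) (hp5 : 5 ≤ p)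
    (hwin : (b 0 + 2 : ℤ) < (p : ℤ) ^ 2) {x : ℕ} (hx : x < p) (hmulti : 2 ≤ classPoleCount b p x) :
    padicNorm p (∑ q ∈ classSet b p x, pfData b 4 q) ≤ (p : ℚ) ^ (-classBound b p x 5) := by
  have h0 : 0 ≤ b 0 := hb.1.1
  unfold classBound
  rw [if_pos hmulti]
  split_ifs with hpal
  · obtain ⟨q, hq⟩ := card_pos.1 (by unfold classPoleCount at hmulti; omega :
      0 < ((classSet b p x).filter fun s => netExp b s < 0).card)
    obtain ⟨hqC, -⟩ := mem_filter.1 hq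
    have hodd : Odd (((5 : ℕ) : ℤ) + classExp b p x) := hpal.2
    have hz : ∑ s ∈ (classSet b p x).filter (fun s => netExp b s ≤ -5), classRho b p s 5 = 0 := by
      have := rhoSum_eq_zero_of_palindromic b h0 hpal.1 (by norm_num : 1 ≤ 5) hodd
      simpa using this
    have hdig := uDigit b hb hp5 hwin hx hqC
    rw [hz, mul_zero, sub_zero] at hdig
    refine padicNorm_le_of_val fun hne => ?_
    have := hdig hne
    push_cast
    linarith
  · refine padicNorm.sum_le' (fun q hq => ?_) (zpow_p_nonneg _)
    by_cases hz : pfData b 4 q = 0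
    · rw [hz, padicNorm.zero]; exact zpow_p_nonneg _
    have hA := clusterBound_holds b p q 4 hb hp.out (by omega) hwin (le_of_mem_classSet b hq) (by norm_num) hz
    rw [classExp_eq_of_mem hq] at hA
    rw [padicNorm.eq_zpow_of_nonzero hz]
    exact zpow_le_zpow_right₀ one_le_p (by push_cast at hA ⊢; linarith)

/-! ### The bound -/

omit hp in
/-- A multipole class bounds `uLBpal` by its row. -/
theorem uLBpal_le_classBound (b : ℕ → ℤ) {x : ℕ} (hx : x < p) (hmulti : 2 ≤ classPoleCount b p x) :
    uLBpal b p ≤ classBound b p x 5 := by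
  unfold uLBpal
  refine getD_min_le (List.mem_append.2 (Or.inl ?_))
  unfold classRowListPal
  exact List.mem_filterMap.2 ⟨x, List.mem_range.2 hx, by rw [if_neg (by omega), if_pos hmulti]⟩

omit hp in
/-- Above the critical range the list carries a `0`. -/
theorem uLBpal_le_zero_of_lt (b : ℕ → ℤ) (h : 2 * dOf b + 3 < 4 * (p : ℤ)) : uLBpal b p ≤ 0 := by
  unfold uLBpal
  exact getD_min_le (List.mem_append.2 (Or.inr (by rw [if_pos h]; simp)))

omit hp in
/-- A multipole `U`-row `≥ 1` forces `5 + E_x ≥ 1`. -/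
theorem one_le_five_add_classExp (b : ℕ → ℤ) {x : ℕ} (hmulti : 2 ≤ classPoleCount b p x)
    (h1 : 1 ≤ classBound b p x 5) : 1 ≤ 5 + classExp b p x := by
  unfold classBound at h1
  rw [if_pos hmulti] at h1
  split_ifs at h1 with hpal
  · obtain ⟨k, hk⟩ := hpal.2
    push_cast at h1 hk
    omega
  · push_cast at h1; linarith

/-- **The palindrome bonus for `U` (census g13's `PalindromicClassBoundU`, in the form `min(uLBpal,1) ≤ v_p(U)`).** -/
theorem min_uLBpal_one_le_padicValRat_coeffU (b : ℕ → ℤ) (hb : InPolytope b) (hp5 : 5 ≤ p)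
    (hwin : (b 0 + 2 : ℤ) < (p : ℤ) ^ 2) (hU : coeffU b ≠ 0) :
    min (uLBpal b p) 1 ≤ padicValRat p (coeffU b) := by
  set w := uLBpal b p with hw
  by_cases hwle : w ≤ 0
  · rw [min_eq_left (by linarith)]
    apply val_ge_of_padicNorm_le hU
    rw [coeffU, ← sum_classSet_eq b hp.out.pos]
    refine padicNorm.sum_le' (fun x hx => ?_) (zpow_p_nonneg _)
    have hx' := mem_range.1 hx
    rcases Nat.lt_trichotomy (classPoleCount b p x) 1 with hc | hc | hc
    · rw [classUsum_eq_zero_of_noPole b hb (by omega), padicNorm.zero]; exact zpow_p_nonneg _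
    · refine (padicNorm_classUsum_le_one b hb hp5 hwin hc).trans ?_
      rw [← zpow_zero (p : ℚ)]
      exact zpow_le_zpow_right₀ one_le_p (by linarith)
    · exact (padicNorm_classUsum_le_classBound b hb hp5 hwin hx' (by omega)).trans
        (zpow_le_zpow_right₀ one_le_p (by linarith [uLBpal_le_classBound b hx' (by omega : 2 ≤ classPoleCount b p x)]))
  · push Not at hwle
    rw [min_eq_right (by linarith)]
    have hpd : 4 * (p : ℤ) ≤ 2 * dOf b + 3 := by
      by_contra h
      push Not at h
      linarith [uLBpal_le_zero_of_lt b h]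
    have hrowK : ∀ x ∈ range p, padicNorm p (classKU b p x) ≤ (p : ℚ) ^ (-(1 : ℤ)) := by
      intro x hx
      have hx' := mem_range.1 hx
      rcases Nat.lt_trichotomy (classPoleCount b p x) 1 with hc | hc | hc
      · rw [classKU_eq_zero_of_noPole b hb (by omega), padicNorm.zero]; exact zpow_p_nonneg _
      · exact (padicNorm_classKU_le' b hb hp5 hwin x).2 hc
      · have h1 := one_le_five_add_classExp b (by omega : 2 ≤ classPoleCount b p x)
          (by linarith [uLBpal_le_classBound b hx' (by omega : 2 ≤ classPoleCount b p x)])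
        exact (padicNorm_classKU_le' b hb hp5 hwin x).1.trans (zpow_le_zpow_right₀ one_le_p (by linarith))
    have hK : padicNorm p (kResU b p) ≤ (p : ℚ) ^ (-(1 : ℤ)) := by
      rw [kResU_eq_sum_classKU b hp.out.pos]; exact padicNorm.sum_le' hrowK (zpow_p_nonneg _)
    apply val_ge_of_padicNorm_le hU
    rw [coeffU_eq_omegaResU_sub_kResU b p, omegaResU_eq_zero b hb hpd, zero_sub, padicNorm.neg]
    exact hK

end Summit.KontsevichZagierPeriods.Zeta5Search.ClusterValuation

end
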